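import Literature.Computability.Cryptography.LWEPrimePowerSolver
import Literature.Computability.Cryptography.LWEPrimePowerZip
import HarnessLib

/-!
# The flat layout of the Micciancio–Peikert machine's raw material: cutting ONE sample stream and ONE coin string into the solver's structured input (MP12 Thm. 3.1, machine bridge)

Topic `Computability/Cryptography` (LWE), grouping namespace `LWE.MP12`, sequel of
`LWEPrimePowerSolver.lean` (`Input`, `inputLaw`, `law_solveDet`) and `LWEPrimePowerZip.lean`
(blocks, zips, uniform chunks). Proved material (no named fact) towards
`Literature.Computability.Cryptography.blprs_gapSVP_sqrt_dim_to_lwe_classical` (**pqc.S21**),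
component Thm. 2.17 = Micciancio–Peikert 2012, Thm. 3.1 (hypothesis `h₂` of
`BLPRSReduction.…_of_components`), for BLPRS's modulus `Q = 2ᵉ` (`p = 2`).

The machine receives `m₁` raw samples `S : Fin m₁ → ℤ_Qᵈ × ℤ_Q` (law `A_{s,χ₁}^{m₁}`) and a uniform
coin string of `L` bits. It cuts the samples into four consecutive segments (estimation, digit-`x`,
digit-`y`, top; `splitSamples`), the coins into the scalar bits — `e` bits per uniform scalar of
`ℤ_Q`, `chunkVal`, exactly uniform because `Q = 2ᵉ` — in eight segments (`splitScalars`) and the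
per-call coin slices in three segments (`splitCoins`), reshapes every segment into nested consecutive
blocks and zips the pieces of every phase together (`estAssemble`, `digAssemble`); the result is the
structured `Input` of `solveDet`. **`law_layout`**: under `A_{s,χ₁}^{m₁} ⊗ U_{coins}` the layout has
EXACTLY the law `inputLaw` (so `law_solveDet` and `eventually_idealLaw_ne_le` apply to the machine).

## References

* D. Micciancio, C. Peikert, *Trapdoors for lattices: simpler, tighter, faster, smaller*, EUROCRYPT 2012,
  LNCS 7237; full version IACR ePrint 2011/501, §3, proof of Thm. 3.1, pp. 15–16. [MicciancioPeikert2012]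
* S. Arora, B. Barak, *Computational Complexity: A Modern Approach*, CUP 2009, Def. 7.1 (the random
  string of a probabilistic machine). [AroraBarak2009]
-/

noncomputable section

open scoped ENNReal

namespace Literature.Computability.Cryptography

namespace LWE

namespace MP12

open Literature.Probability.Distributions

/-! ### Regrouping independent components -/

section Regroup

variable {A A' B B' C C' D : Type}

/-- `((a, a'), ((b, b'), (c, c'))) ↦ ((a, (b, c)), (a', (b', c')))`. [folklore] -/
def regroup₃₂ : (A × A') × ((B × B') × (C × C')) ≃ (A × (B × C)) × (A' × (B' × C')) where
  toFun x := ((x.1.1, (x.2.1.1, x.2.2.1)), (x.1.2, (x.2.1.2, x.2.2.2)))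
  invFun y := ((y.1.1, y.2.1), ((y.1.2.1, y.2.2.1), (y.1.2.2, y.2.2.2)))
  left_inv := fun ⟨⟨_, _⟩, ⟨⟨_, _⟩, ⟨_, _⟩⟩⟩ => rfl
  right_inv := fun ⟨⟨_, ⟨_, _⟩⟩, ⟨_, ⟨_, _⟩⟩⟩ => rfl

/-- **Taking one component from each of three independent pairs.** [folklore] -/
theorem prodLaw_map_regroup₃₂ (PA : PMF A) (PA' : PMF A') (PB : PMF B) (PB' : PMF B') (PC : PMF C) (PC' : PMF C') :
    (prodLaw (prodLaw PA PA') (prodLaw (prodLaw PB PB') (prodLaw PC PC'))).map regroup₃₂ =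
      prodLaw (prodLaw PA (prodLaw PB PC)) (prodLaw PA' (prodLaw PB' PC')) := by
  ext ⟨⟨a, ⟨b, c⟩⟩, ⟨a', ⟨b', c'⟩⟩⟩
  rw [pmf_map_equiv_apply]
  simp only [regroup₃₂, Equiv.coe_fn_symm_mk, prodLaw_apply]
  ring

/-- `(a, ((b, c), d)) ↦ ((a, b), (c, d))`. [folklore] -/
def regroup₁₂₁ : A × ((B × C) × D) ≃ (A × B) × (C × D) where
  toFun x := ((x.1, x.2.1.1), (x.2.1.2, x.2.2))
  invFun y := (y.1.1, ((y.1.2, y.2.1), y.2.2))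
  left_inv := fun ⟨_, ⟨⟨_, _⟩, _⟩⟩ => rfl
  right_inv := fun ⟨⟨_, _⟩, ⟨_, _⟩⟩ => rfl

/-- Regrouping `a ⊗ ((b ⊗ c) ⊗ d)` as `(a ⊗ b) ⊗ (c ⊗ d)`. [folklore] -/
theorem prodLaw_map_regroup₁₂₁ (PA : PMF A) (PB : PMF B) (PC : PMF C) (PD : PMF D) :
    (prodLaw PA (prodLaw (prodLaw PB PC) PD)).map regroup₁₂₁ = prodLaw (prodLaw PA PB) (prodLaw PC PD) := by
  ext ⟨⟨a, b⟩, ⟨c, d'⟩⟩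
  rw [pmf_map_equiv_apply]
  simp only [regroup₁₂₁, Equiv.coe_fn_symm_mk, prodLaw_apply]
  ring

/-- Associativity `((a, b), c) ↦ (a, (b, c))`. [folklore] -/
theorem prodLaw_map_prodAssoc (PA : PMF A) (PB : PMF B) (PC : PMF C) :
    (prodLaw (prodLaw PA PB) PC).map (Equiv.prodAssoc A B C) = prodLaw PA (prodLaw PB PC) := by
  ext ⟨a, ⟨b, c⟩⟩
  rw [pmf_map_equiv_apply]
  simp only [Equiv.prodAssoc_symm_apply, prodLaw_apply]
  ring

end Regroup

/-! ### Named zips and their laws -/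

section Zips

variable {ι κ μ ν α β A B C : Type}

/-- Zipping two depth-2 nests. [folklore] -/
def zip2 (x : (ι → κ → α) × (ι → κ → β)) : ι → κ → α × β := fun i j => (x.1 i j, x.2 i j)

/-- Zipping two depth-3 nests. [folklore] -/
def zip3 (x : (ι → κ → μ → α) × (ι → κ → μ → β)) : ι → κ → μ → α × β := fun i j k => (x.1 i j k, x.2 i j k)

/-- Zipping two depth-4 nests. [folklore] -/
def zip4 (x : (ι → κ → μ → ν → α) × (ι → κ → μ → ν → β)) : ι → κ → μ → ν → α × β :=
  fun i j k l => (x.1 i j k l, x.2 i j k l)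

/-- `zip_iid₂` for the named zip. [cite: RegevLWE2009, §2 (independent samples)] -/
theorem law_zip2 (P : PMF α) (Q : PMF β) (m n : ℕ) :
    (prodLaw (iidPMF (iidPMF P m) n) (iidPMF (iidPMF Q m) n)).map zip2 = iidPMF (iidPMF (prodLaw P Q) m) n :=
  zip_iid₂ P Q m n

/-- `zip_iid₃` for the named zip. [cite: RegevLWE2009, §2 (independent samples)] -/
theorem law_zip3 (P : PMF α) (Q : PMF β) (l m n : ℕ) :
    (prodLaw (iidPMF (iidPMF (iidPMF P l) m) n) (iidPMF (iidPMF (iidPMF Q l) m) n)).map zip3 =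
      iidPMF (iidPMF (iidPMF (prodLaw P Q) l) m) n :=
  zip_iid₃ P Q l m n

/-- `zip_iid₄` for the named zip. [cite: RegevLWE2009, §2 (independent samples)] -/
theorem law_zip4 (P : PMF α) (Q : PMF β) (k l m n : ℕ) :
    (prodLaw (iidPMF (iidPMF (iidPMF (iidPMF P k) l) m) n) (iidPMF (iidPMF (iidPMF (iidPMF Q k) l) m) n)).map zip4 =
      iidPMF (iidPMF (iidPMF (iidPMF (prodLaw P Q) k) l) m) n :=
  zip_iid₄ P Q k l m n

/-- Associativity, inverse direction. [folklore] -/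
theorem prodLaw_map_prodAssoc_symm (PA : PMF A) (PB : PMF B) (PC : PMF C) :
    (prodLaw PA (prodLaw PB PC)).map (Equiv.prodAssoc A B C).symm = prodLaw (prodLaw PA PB) PC := by
  ext ⟨⟨a, b⟩, c⟩
  rw [pmf_map_equiv_apply]
  simp only [Equiv.symm_symm, Equiv.prodAssoc_apply, prodLaw_apply]
  ring

end Zips

/-! ### Deep maps inside iid nests -/

section DeepMap

variable {α β : Type}

/-- Mapping the leaves of a depth-4 iid nest. [folklore] -/
theorem map_iid₄ (P : PMF α) (F : α → β) (k l m n : ℕ) :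
    (iidPMF (iidPMF (iidPMF (iidPMF P k) l) m) n).map (fun g i j r q => F (g i j r q)) =
      iidPMF (iidPMF (iidPMF (iidPMF (P.map F) k) l) m) n := by
  rw [← iidPMF_map, ← iidPMF_map, ← iidPMF_map, ← iidPMF_map]
  rfl

end DeepMap

/-! ### The estimation phase's material -/

section Est

variable (d e K' m N' ℓ : ℕ)

/-- **Assembling the estimation data** from its four flat segments: samples (`(e+1)·N'·m·(K'+1)`),
level scalars (`(e+1)·N'·m`), shift scalars (`(e+1)·N'·d`), coin slices (`(e+1)·N'·ℓ` bits).
[cite: MicciancioPeikert2012, Thm. 3.1 proof (p. 15)] -/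
def estAssemble
    (x : (Fin ((e + 1) * (N' * (m * (K' + 1)))) → (Fin d → ZMod (2 ^ e)) × ZMod (2 ^ e)) ×
      (((Fin ((e + 1) * (N' * m)) → ZMod (2 ^ e)) × (Fin ((e + 1) * (N' * d)) → ZMod (2 ^ e))) ×
        (Fin ((e + 1) * (N' * ℓ)) → Bool))) :
    EstData d 2 e K' m N' (Fin ℓ → Bool) :=
  fun j k => (((fun i => (blocks₃ (e + 1) N' m (K' + 1) x.1 j k i, blocks₂ (e + 1) N' m x.2.1.1 j k i)),
    blocks₂ (e + 1) N' d x.2.1.2 j k), blocks₂ (e + 1) N' ℓ x.2.2 j k)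

/-- The law of the estimation phase's flat segments. [folklore] -/
def estSourceLaw (χ₁ : PMF (ZMod (2 ^ e))) (s : Fin d → ZMod (2 ^ e)) :
    PMF ((Fin ((e + 1) * (N' * (m * (K' + 1)))) → (Fin d → ZMod (2 ^ e)) × ZMod (2 ^ e)) ×
      (((Fin ((e + 1) * (N' * m)) → ZMod (2 ^ e)) × (Fin ((e + 1) * (N' * d)) → ZMod (2 ^ e))) ×
        (Fin ((e + 1) * (N' * ℓ)) → Bool))) :=
  prodLaw (iidPMF (lweSample χ₁ s) _)
    (prodLaw (prodLaw (iidPMF (PMF.uniformOfFintype (ZMod (2 ^ e))) _) (iidPMF (PMF.uniformOfFintype (ZMod (2 ^ e))) _))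
      (iidPMF (PMF.uniformOfFintype Bool) _))

/-- **The assembled estimation data has the law `estDataLaw`.** [cite: MicciancioPeikert2012, Thm. 3.1 proof (p. 15)] -/
theorem law_estAssemble (χ₁ : PMF (ZMod (2 ^ e))) (s : Fin d → ZMod (2 ^ e)) :
    (estSourceLaw d e K' m N' ℓ χ₁ s).map (estAssemble d e K' m N' ℓ) =
      estDataLaw K' m N' χ₁ s (C := Fin ℓ → Bool) := by
  have h : estAssemble d e K' m N' ℓ =
      zip2 ∘ Prod.map zip2 id ∘ (Equiv.prodAssoc _ _ _).symm ∘ Prod.map zip3 id ∘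
        Prod.map (Prod.map (blocks₃ (e + 1) N' m (K' + 1)) (blocks₂ (e + 1) N' m))
          (Prod.map (blocks₂ (e + 1) N' d) (blocks₂ (e + 1) N' ℓ)) ∘ regroup₁₂₁ := by
    funext x
    rfl
  rw [h, ← PMF.map_comp, ← PMF.map_comp, ← PMF.map_comp, ← PMF.map_comp, ← PMF.map_comp, estSourceLaw,
    prodLaw_map_regroup₁₂₁]
  simp only [prodLaw_map_prodMap, PMF.map_id, iidPMF_map_blocks₃, iidPMF_map_blocks₂, law_zip3,
    prodLaw_map_prodAssoc_symm]
  rw [iidPMF_uniformOfFintype_eq (β := ZMod (2 ^ e)) d, law_zip2, iidPMF_uniformOfFintype_eq (β := Bool) ℓ, law_zip2]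
  rfl

end Est

/-! ### Consecutive segments of a stream -/

section Split

variable {α : Type}

/-- Two consecutive segments. [folklore] -/
def split2 (a b : ℕ) (v : Fin (a + b) → α) : (Fin a → α) × (Fin b → α) := (Fin.appendEquiv a b).symm v

/-- Three consecutive segments. [folklore] -/
def split3 (a b c : ℕ) (v : Fin (a + (b + c)) → α) : (Fin a → α) × ((Fin b → α) × (Fin c → α)) :=
  Prod.map id (split2 b c) (split2 a (b + c) v)

/-- Four consecutive segments. [folklore] -/
def split4 (a b c d : ℕ) (v : Fin (a + (b + (c + d))) → α) : (Fin a → α) × ((Fin b → α) × ((Fin c → α) × (Fin d → α))) :=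
  Prod.map id (split3 b c d) (split2 a (b + (c + d)) v)

/-- Eight consecutive segments. [folklore] -/
def split8 (n₁ n₂ n₃ n₄ n₅ n₆ n₇ n₈ : ℕ) (v : Fin (n₁ + (n₂ + (n₃ + (n₄ + (n₅ + (n₆ + (n₇ + n₈))))))) → α) :
    (Fin n₁ → α) × ((Fin n₂ → α) × ((Fin n₃ → α) × ((Fin n₄ → α) × ((Fin n₅ → α) × ((Fin n₆ → α) ×
      ((Fin n₇ → α) × (Fin n₈ → α))))))) :=
  (Prod.map id (Prod.map id (Prod.map id (Prod.map id (split4 n₅ n₆ n₇ n₈) ∘ split2 n₄ _) ∘ split2 n₃ _) ∘ split2 n₂ _) ∘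
    split2 n₁ _) v

/-- Law of two segments of an iid stream. [cite: RegevLWE2009, §2 (independent samples)] -/
theorem law_split2 (P : PMF α) (a b : ℕ) : (iidPMF P (a + b)).map (split2 a b) = prodLaw (iidPMF P a) (iidPMF P b) :=
  iidPMF_map_appendEquiv_symm P a b

/-- Law of three segments. [cite: RegevLWE2009, §2 (independent samples)] -/
theorem law_split3 (P : PMF α) (a b c : ℕ) :
    (iidPMF P (a + (b + c))).map (split3 a b c) = prodLaw (iidPMF P a) (prodLaw (iidPMF P b) (iidPMF P c)) := by
  rw [show split3 (α := α) a b c = Prod.map id (split2 b c) ∘ split2 a (b + c) from rfl, ← PMF.map_comp, law_split2,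
    prodLaw_map_prodMap, PMF.map_id, law_split2]

/-- Law of four segments. [cite: RegevLWE2009, §2 (independent samples)] -/
theorem law_split4 (P : PMF α) (a b c d : ℕ) :
    (iidPMF P (a + (b + (c + d)))).map (split4 a b c d) =
      prodLaw (iidPMF P a) (prodLaw (iidPMF P b) (prodLaw (iidPMF P c) (iidPMF P d))) := by
  rw [show split4 (α := α) a b c d = Prod.map id (split3 b c d) ∘ split2 a (b + (c + d)) from rfl, ← PMF.map_comp,
    law_split2, prodLaw_map_prodMap, PMF.map_id, law_split3]

/-- Law of eight segments. [cite: RegevLWE2009, §2 (independent samples)] -/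
theorem law_split8 (P : PMF α) (n₁ n₂ n₃ n₄ n₅ n₆ n₇ n₈ : ℕ) :
    (iidPMF P (n₁ + (n₂ + (n₃ + (n₄ + (n₅ + (n₆ + (n₇ + n₈)))))))).map (split8 n₁ n₂ n₃ n₄ n₅ n₆ n₇ n₈) =
      prodLaw (iidPMF P n₁) (prodLaw (iidPMF P n₂) (prodLaw (iidPMF P n₃) (prodLaw (iidPMF P n₄)
        (prodLaw (iidPMF P n₅) (prodLaw (iidPMF P n₆) (prodLaw (iidPMF P n₇) (iidPMF P n₈))))))) := by
  unfold split8
  simp only [← PMF.map_comp, law_split2, prodLaw_map_prodMap, PMF.map_id, law_split4]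

end Split

/-! ### The digit phase's material -/

section Dig

variable (d e K' m N T ℓ : ℕ)

/-- The ten flat segments of the digit phase, grouped by stream: samples `(x, y)`; scalars
`(xl, (xr, (yρ, (yl, (yr, τ)))))`; coins `(cx, cy)`. [folklore] -/
abbrev DigSource (d e K' m N T ℓ : ℕ) : Type :=
  ((Fin (d * (e * (2 * (T * (N * (m * (K' + 1))))))) → (Fin d → ZMod (2 ^ e)) × ZMod (2 ^ e)) ×
    (Fin (d * (e * (2 * (T * (N * (m * (K' + 1))))))) → (Fin d → ZMod (2 ^ e)) × ZMod (2 ^ e))) ×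
  (((Fin (d * (e * (2 * (T * (N * m))))) → ZMod (2 ^ e)) × ((Fin (d * (e * (2 * (T * (N * m))))) → ZMod (2 ^ e)) ×
    ((Fin (d * (e * (2 * (T * (N * m))))) → ZMod (2 ^ e)) × ((Fin (d * (e * (2 * (T * (N * m))))) → ZMod (2 ^ e)) ×
    ((Fin (d * (e * (2 * (T * (N * m))))) → ZMod (2 ^ e)) × (Fin (d * (e * (2 * (T * d)))) → ZMod (2 ^ e))))))) ×
  ((Fin (d * (e * (2 * (T * (N * ℓ))))) → Bool) × (Fin (d * (e * (2 * (T * (N * ℓ))))) → Bool)))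

/-- Regrouping the digit segments by item: `(τ, (((xl, (x, xr)), (yρ, (yl, (y, yr)))), (cx, cy)))`. [folklore] -/
def regroupDig {SX SY XL XR YR YL YRR TAU CX CY : Type} :
    (SX × SY) × ((XL × (XR × (YR × (YL × (YRR × TAU))))) × (CX × CY)) ≃
      TAU × (((XL × (SX × XR)) × (YR × (YL × (SY × YRR)))) × (CX × CY)) where
  toFun x := (x.2.1.2.2.2.2.2, (((x.2.1.1, (x.1.1, x.2.1.2.1)), (x.2.1.2.2.1, (x.2.1.2.2.2.1, (x.1.2, x.2.1.2.2.2.2.1)))), x.2.2))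
  invFun y := ((y.2.1.1.2.1, y.2.1.2.2.2.1), ((y.2.1.1.1, (y.2.1.1.2.2, (y.2.1.2.1, (y.2.1.2.2.1, (y.2.1.2.2.2.2, y.1))))), y.2.2))
  left_inv := fun ⟨⟨_, _⟩, ⟨⟨_, ⟨_, ⟨_, ⟨_, ⟨_, _⟩⟩⟩⟩⟩, ⟨_, _⟩⟩⟩ => rfl
  right_inv := fun ⟨_, ⟨⟨⟨_, ⟨_, _⟩⟩, ⟨_, ⟨_, ⟨_, _⟩⟩⟩⟩, ⟨_, _⟩⟩⟩ => rfl

/-- Law of the regrouped digit segments. [folklore] -/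
theorem prodLaw_map_regroupDig {SX SY XL XR YR YL YRR TAU CX CY : Type} (P₁ : PMF SX) (P₂ : PMF SY) (Q₁ : PMF XL)
    (Q₂ : PMF XR) (Q₃ : PMF YR) (Q₄ : PMF YL) (Q₅ : PMF YRR) (Q₆ : PMF TAU) (R₁ : PMF CX) (R₂ : PMF CY) :
    (prodLaw (prodLaw P₁ P₂) (prodLaw (prodLaw Q₁ (prodLaw Q₂ (prodLaw Q₃ (prodLaw Q₄ (prodLaw Q₅ Q₆))))) (prodLaw R₁ R₂))).map
        regroupDig =
      prodLaw Q₆ (prodLaw (prodLaw (prodLaw Q₁ (prodLaw P₁ Q₂)) (prodLaw Q₃ (prodLaw Q₄ (prodLaw P₂ Q₅)))) (prodLaw R₁ R₂)) := by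
  ext ⟨τ, ⟨⟨⟨xl, ⟨sx, xr⟩⟩, ⟨yρ, ⟨yl, ⟨sy, yr⟩⟩⟩⟩, ⟨cx, cy⟩⟩⟩
  rw [pmf_map_equiv_apply]
  simp only [regroupDig, Equiv.coe_fn_symm_mk, prodLaw_apply]
  ring

/-- Reshaping a depth-4 block structure with a further reshaping `F` of the leaves. [folklore] -/
def nest4 {α β : Type} (f : ℕ) (F : (Fin f → α) → β) (v : Fin (d * (e * (2 * (T * f)))) → α) : Fin d → Fin e → Fin 2 → Fin T → β :=
  fun c i k t => F (blocks₄ d e 2 T f v c i k t)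

/-- Law of `nest4` on an iid stream. [cite: RegevLWE2009, §2 (independent samples)] -/
theorem law_nest4 {α β : Type} (P : PMF α) (f : ℕ) (F : (Fin f → α) → β) :
    (iidPMF P (d * (e * (2 * (T * f))))).map (nest4 d e T f F) =
      iidPMF (iidPMF (iidPMF (iidPMF ((iidPMF P f).map F) T) 2) e) d := by
  rw [show nest4 (α := α) d e T f F = (fun g c i k t => F (g c i k t)) ∘ blocks₄ d e 2 T f from rfl, ← PMF.map_comp,
    iidPMF_map_blocks₄, map_iid₄]

/-- Zip two depth-4 nests and reshape the paired leaves. [folklore] -/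
def zipLeaf4 {α β γ : Type} (G : α × β → γ) (x : (Fin d → Fin e → Fin 2 → Fin T → α) × (Fin d → Fin e → Fin 2 → Fin T → β)) :
    Fin d → Fin e → Fin 2 → Fin T → γ :=
  fun c i k t => G (x.1 c i k t, x.2 c i k t)

/-- Law of `zipLeaf4` on independent iid nests. [cite: RegevLWE2009, §2 (independent samples)] -/
theorem law_zipLeaf4 {α β γ : Type} (G : α × β → γ) (P : PMF α) (Q : PMF β) :
    (prodLaw (iidPMF (iidPMF (iidPMF (iidPMF P T) 2) e) d) (iidPMF (iidPMF (iidPMF (iidPMF Q T) 2) e) d)).map (zipLeaf4 d e T G) =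
      iidPMF (iidPMF (iidPMF (iidPMF ((prodLaw P Q).map G) T) 2) e) d := by
  rw [show zipLeaf4 (α := α) (β := β) d e T G = (fun g c i k t => G (g c i k t)) ∘ zip4 from rfl, ← PMF.map_comp,
    law_zip4, map_iid₄]

/-- **Assembling the digit data** from its ten flat segments. [cite: MicciancioPeikert2012, Thm. 3.1 proof (p. 16)] -/
def digAssemble (x : DigSource d e K' m N T ℓ) : DigData d 2 e K' m N T (Fin ℓ → Bool) :=
  let y := regroupDig x
  -- reshape
  let τ := nest4 d e T d id y.1
  let xl := nest4 d e T (N * m) (blocksOf N m) y.2.1.1.1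
  let sx := nest4 d e T (N * (m * (K' + 1))) (blocks₂ N m (K' + 1)) y.2.1.1.2.1
  let xr := nest4 d e T (N * m) (blocksOf N m) y.2.1.1.2.2
  let yρ := nest4 d e T (N * m) (blocksOf N m) y.2.1.2.1
  let yl := nest4 d e T (N * m) (blocksOf N m) y.2.1.2.2.1
  let sy := nest4 d e T (N * (m * (K' + 1))) (blocks₂ N m (K' + 1)) y.2.1.2.2.2.1
  let yr := nest4 d e T (N * m) (blocksOf N m) y.2.1.2.2.2.2
  let cx := nest4 d e T (N * ℓ) (blocksOf N ℓ) y.2.2.1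
  let cy := nest4 d e T (N * ℓ) (blocksOf N ℓ) y.2.2.2
  -- zip the items
  let xraw := zipLeaf4 d e T zip2 (sx, xr)
  let xitems := zipLeaf4 d e T zip2 (xl, xraw)
  let yraw := zipLeaf4 d e T zip2 (sy, yr)
  let yx := zipLeaf4 d e T zip2 (yl, yraw)
  let yitems := zipLeaf4 d e T zip2 (yρ, yx)
  let xy := zipLeaf4 d e T id (xitems, yitems)
  let cc := zipLeaf4 d e T id (cx, cy)
  let body := zipLeaf4 d e T id (xy, cc)
  zipLeaf4 d e T id (τ, body)

/-- The law of the digit phase's flat segments. [folklore] -/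
def digSourceLaw (χ₁ : PMF (ZMod (2 ^ e))) (s : Fin d → ZMod (2 ^ e)) : PMF (DigSource d e K' m N T ℓ) :=
  prodLaw (prodLaw (iidPMF (lweSample χ₁ s) _) (iidPMF (lweSample χ₁ s) _))
    (prodLaw
      (prodLaw (iidPMF (PMF.uniformOfFintype (ZMod (2 ^ e))) _) (prodLaw (iidPMF (PMF.uniformOfFintype (ZMod (2 ^ e))) _)
        (prodLaw (iidPMF (PMF.uniformOfFintype (ZMod (2 ^ e))) _) (prodLaw (iidPMF (PMF.uniformOfFintype (ZMod (2 ^ e))) _)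
          (prodLaw (iidPMF (PMF.uniformOfFintype (ZMod (2 ^ e))) _) (iidPMF (PMF.uniformOfFintype (ZMod (2 ^ e))) _))))))
      (prodLaw (iidPMF (PMF.uniformOfFintype Bool) _) (iidPMF (PMF.uniformOfFintype Bool) _)))

/-- **The assembled digit data has the law `digDataLaw`.** [cite: MicciancioPeikert2012, Thm. 3.1 proof (p. 16)] -/
theorem law_digAssemble (χ₁ : PMF (ZMod (2 ^ e))) (s : Fin d → ZMod (2 ^ e)) :
    (digSourceLaw d e K' m N T ℓ χ₁ s).map (digAssemble d e K' m N T ℓ) =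
      digDataLaw K' m N T χ₁ s (C := Fin ℓ → Bool) := by
  have h : digAssemble d e K' m N T ℓ =
      zipLeaf4 d e T id ∘
      Prod.map id (zipLeaf4 d e T id ∘
        Prod.map
          (zipLeaf4 d e T id ∘
            Prod.map (zipLeaf4 d e T zip2 ∘ Prod.map id (zipLeaf4 d e T zip2))
              (zipLeaf4 d e T zip2 ∘ Prod.map id (zipLeaf4 d e T zip2 ∘ Prod.map id (zipLeaf4 d e T zip2))))
          (zipLeaf4 d e T id)) ∘
      Prod.map (nest4 d e T d id)
        (Prod.map
          (Prod.map
            (Prod.map (nest4 d e T (N * m) (blocksOf N m))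
              (Prod.map (nest4 d e T (N * (m * (K' + 1))) (blocks₂ N m (K' + 1))) (nest4 d e T (N * m) (blocksOf N m))))
            (Prod.map (nest4 d e T (N * m) (blocksOf N m))
              (Prod.map (nest4 d e T (N * m) (blocksOf N m))
                (Prod.map (nest4 d e T (N * (m * (K' + 1))) (blocks₂ N m (K' + 1))) (nest4 d e T (N * m) (blocksOf N m))))))
          (Prod.map (nest4 d e T (N * ℓ) (blocksOf N ℓ)) (nest4 d e T (N * ℓ) (blocksOf N ℓ)))) ∘
      regroupDig := by
    funext x
    rfl
  rw [h, ← PMF.map_comp, ← PMF.map_comp, ← PMF.map_comp, digSourceLaw, prodLaw_map_regroupDig]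
  simp only [prodLaw_map_prodMap, PMF.map_id, law_nest4, iidPMF_map_blocksOf, iidPMF_map_blocks₂, ← PMF.map_comp,
    law_zipLeaf4, law_zip2]
  rw [iidPMF_uniformOfFintype_eq (β := ZMod (2 ^ e)) d, iidPMF_uniformOfFintype_eq (β := Bool) ℓ]
  rfl

end Dig

/-! ### The whole layout -/

section Layout

variable (d e K' m N T N' m' ℓ : ℕ)

/-- Number of estimation samples. [folklore] -/
abbrev nEs : ℕ := (e + 1) * (N' * (m * (K' + 1)))

/-- Number of `x`-samples (and of `y`-samples) of the digit phase. [folklore] -/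
abbrev nXs : ℕ := d * (e * (2 * (T * (N * (m * (K' + 1))))))

/-- **The number of input samples of the machine.** [cite: MicciancioPeikert2012, Thm. 3.1 proof (pp. 15–16)] -/
abbrev numSamples : ℕ := nEs e K' m N' + (nXs d e K' m N T + (nXs d e K' m N T + m'))

/-- Scalar counts: estimation levels, estimation shifts, one digit-phase family, the worst-case shifts. [folklore] -/
abbrev rEl : ℕ := (e + 1) * (N' * m)
/-- See `rEl`. [folklore] -/
abbrev rEs : ℕ := (e + 1) * (N' * d)
/-- See `rEl`. [folklore] -/
abbrev rX : ℕ := d * (e * (2 * (T * (N * m))))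
/-- See `rEl`. [folklore] -/
abbrev rTau : ℕ := d * (e * (2 * (T * d)))

/-- **The number of uniform scalars.** [folklore] -/
abbrev numScalars : ℕ :=
  rEl e m N' + (rEs d e N' + (rX d e m N T + (rX d e m N T + (rX d e m N T + (rX d e m N T + (rX d e m N T + rTau d e T))))))

/-- Coin-slice counts (bits): estimation calls, one digit-phase family of calls. [folklore] -/
abbrev cE : ℕ := (e + 1) * (N' * ℓ)
/-- See `cE`. [folklore] -/
abbrev cX : ℕ := d * (e * (2 * (T * (N * ℓ))))

/-- The number of coin bits of the oracle calls. [folklore] -/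
abbrev numCallBits : ℕ := cE e N' ℓ + (cX d e N T ℓ + cX d e N T ℓ)

/-- **The number of coins the machine reads.** [cite: AroraBarak2009, Def. 7.1] -/
abbrev numCoins : ℕ := numScalars d e m N T N' * e + numCallBits d e N T N' ℓ

/-- The uniform scalars from their bits: `e` consecutive coins per scalar. [cite: AroraBarak2009, Def. 7.1] -/
def scalarsOf (rbits : Fin (numScalars d e m N T N' * e) → Bool) : Fin (numScalars d e m N T N') → ZMod (2 ^ e) :=
  fun i => chunkVal e (blocksOf _ e rbits i)

/-- **Uniform coins give iid uniform scalars.** [cite: AroraBarak2009, Def. 7.1] -/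
theorem law_scalarsOf :
    (iidPMF (PMF.uniformOfFintype Bool) (numScalars d e m N T N' * e)).map (scalarsOf d e m N T N') =
      iidPMF (PMF.uniformOfFintype (ZMod (2 ^ e))) (numScalars d e m N T N') := by
  rw [show scalarsOf d e m N T N' = (fun v => chunkVal e ∘ v) ∘ blocksOf _ e from rfl, ← PMF.map_comp, iidPMF_map_blocksOf,
    iidPMF_map, iidPMF_uniformOfFintype_eq, uniformOfFintype_map_chunkVal]

/-- Regrouping the fifteen segments by phase:
`((sE, ((rEl, rEs), cE)), (((sX, sY), (digit scalars, (cX, cY))), sTop))`. [folklore] -/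
def regroupTop {S₁ S₂ S₃ S₄ R₁ R₂ R₃ R₄ R₅ R₆ R₇ R₈ C₁ C₂ C₃ : Type} :
    (S₁ × (S₂ × (S₃ × S₄))) × ((R₁ × (R₂ × (R₃ × (R₄ × (R₅ × (R₆ × (R₇ × R₈))))))) × (C₁ × (C₂ × C₃))) ≃
      (S₁ × ((R₁ × R₂) × C₁)) × (((S₂ × S₃) × ((R₃ × (R₄ × (R₅ × (R₆ × (R₇ × R₈))))) × (C₂ × C₃))) × S₄) where
  toFun x := ((x.1.1, ((x.2.1.1, x.2.1.2.1), x.2.2.1)), (((x.1.2.1, x.1.2.2.1), (x.2.1.2.2, x.2.2.2)), x.1.2.2.2))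
  invFun y := ((y.1.1, (y.2.1.1.1, (y.2.1.1.2, y.2.2))), ((y.1.2.1.1, (y.1.2.1.2, y.2.1.2.1)), (y.1.2.2, y.2.1.2.2)))
  left_inv := fun ⟨⟨_, ⟨_, ⟨_, _⟩⟩⟩, ⟨⟨_, ⟨_, _⟩⟩, ⟨_, _⟩⟩⟩ => rfl
  right_inv := fun ⟨⟨_, ⟨⟨_, _⟩, _⟩⟩, ⟨⟨⟨_, _⟩, ⟨_, _⟩⟩, _⟩⟩ => rfl

/-- Law of the phase regrouping. [folklore] -/
theorem prodLaw_map_regroupTop {S₁ S₂ S₃ S₄ R₁ R₂ R₃ R₄ R₅ R₆ R₇ R₈ C₁ C₂ C₃ : Type} (P₁ : PMF S₁) (P₂ : PMF S₂) (P₃ : PMF S₃)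
    (P₄ : PMF S₄) (Q₁ : PMF R₁) (Q₂ : PMF R₂) (Q : PMF (R₃ × (R₄ × (R₅ × (R₆ × (R₇ × R₈)))))) (U₁ : PMF C₁) (U₂ : PMF C₂)
    (U₃ : PMF C₃) :
    (prodLaw (prodLaw P₁ (prodLaw P₂ (prodLaw P₃ P₄))) (prodLaw (prodLaw Q₁ (prodLaw Q₂ Q)) (prodLaw U₁ (prodLaw U₂ U₃)))).map
        regroupTop =
      prodLaw (prodLaw P₁ (prodLaw (prodLaw Q₁ Q₂) U₁)) (prodLaw (prodLaw (prodLaw P₂ P₃) (prodLaw Q (prodLaw U₂ U₃))) P₄) := by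
  ext ⟨⟨s₁, ⟨⟨r₁, r₂⟩, c₁⟩⟩, ⟨⟨⟨s₂, s₃⟩, ⟨q, ⟨c₂, c₃⟩⟩⟩, s₄⟩⟩
  rw [pmf_map_equiv_apply]
  simp only [regroupTop, Equiv.coe_fn_symm_mk, prodLaw_apply]
  ring

/-- **The layout**: cut the sample stream and the coin string into the solver's structured input.
[cite: MicciancioPeikert2012, Thm. 3.1 proof (pp. 15–16)] -/
def layout (x : (Fin (numSamples d e K' m N T N' m') → (Fin d → ZMod (2 ^ e)) × ZMod (2 ^ e)) × (Fin (numCoins d e m N T N' ℓ) → Bool)) :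
    Input d 2 e K' m N T N' m' (Fin ℓ → Bool) :=
  let y := regroupTop (Prod.map (split4 (nEs e K' m N') (nXs d e K' m N T) (nXs d e K' m N T) m')
    (Prod.map (split8 (rEl e m N') (rEs d e N') (rX d e m N T) (rX d e m N T) (rX d e m N T) (rX d e m N T) (rX d e m N T)
        (rTau d e T) ∘ scalarsOf d e m N T N')
      (split3 (cE e N' ℓ) (cX d e N T ℓ) (cX d e N T ℓ)) ∘ split2 _ _) x)
  (estAssemble d e K' m N' ℓ y.1, (digAssemble d e K' m N T ℓ y.2.1, y.2.2))

/-- **The layout has the law `inputLaw`** under `A_{s,χ₁}^{m₁} ⊗ U_{coins}`. [cite: MicciancioPeikert2012, Thm. 3.1 proof (pp. 15–16)] -/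
theorem law_layout (χ₁ : PMF (ZMod (2 ^ e))) (s : Fin d → ZMod (2 ^ e)) :
    (prodLaw (lweSamples χ₁ s (numSamples d e K' m N T N' m')) (PMF.uniformOfFintype (Fin (numCoins d e m N T N' ℓ) → Bool))).map
        (layout d e K' m N T N' m' ℓ) =
      inputLaw K' m N T N' m' χ₁ s (C := Fin ℓ → Bool) := by
  rw [show layout d e K' m N T N' m' ℓ =
      Prod.map (estAssemble d e K' m N' ℓ) (Prod.map (digAssemble d e K' m N T ℓ) id) ∘ regroupTop ∘
        Prod.map (split4 (nEs e K' m N') (nXs d e K' m N T) (nXs d e K' m N T) m')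
          (Prod.map (split8 (rEl e m N') (rEs d e N') (rX d e m N T) (rX d e m N T) (rX d e m N T) (rX d e m N T) (rX d e m N T)
              (rTau d e T) ∘ scalarsOf d e m N T N')
            (split3 (cE e N' ℓ) (cX d e N T ℓ) (cX d e N T ℓ)) ∘ split2 _ _) from funext fun x => rfl,
    ← PMF.map_comp, ← PMF.map_comp, lweSamples, ← iidPMF_uniformOfFintype_eq]
  simp only [prodLaw_map_prodMap, ← PMF.map_comp, law_split2, law_split3, law_split4, law_split8, law_scalarsOf]
  have hE := law_estAssemble d e K' m N' ℓ χ₁ s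
  have hD := law_digAssemble d e K' m N T ℓ χ₁ s
  rw [estSourceLaw] at hE
  rw [digSourceLaw] at hD
  rw [prodLaw_map_regroupTop, prodLaw_map_prodMap, prodLaw_map_prodMap, PMF.map_id, hE, hD]
  rfl

end Layout

end MP12

end LWE

end Literature.Computability.Cryptography

end
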